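/-
Copyright: lit-balaban Phase-2 proof seat p27 (gen 32).  Statement-level skeleton of a published paper; no proof claims beyond what the
kernel checks below.
-/
import Literature.MathematicalPhysics.QuantumFieldTheory.BalabanImbrieJaffe1984to88.BIJ85ScalarPropagatorDecay
import Literature.MathematicalPhysics.QuantumFieldTheory.BalabanImbrieJaffe1984to88.BIJ88NeumannPropagatorFlatDecay

/-!
# [BalabanImbrieJaffe1985] §7.3, p. 326 — the SUP-NORM decay of the covariant block propagator `G_k(u) = [D_u^*D_u + a_kQ_k(u)^*Q_k(u)]⁻¹`
# at NON-FLAT small fields, kernel file 1 of 3: the free massive resolvent `R = (−Δ^ε + m)⁻¹` on the fine torus (minimum principle,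
# free Agmon bound, resolvent identity against the flat block propagator `G_k(T_ε,0)`, tilted `ℓ²` bound of the block average, weights)

T. Bałaban, J. Imbrie, A. Jaffe, *Renormalization of the Higgs model: minimizers, propagators and the stability of mean field theory*,
Commun. Math. Phys. **97** (1985) 299–329 [BalabanImbrieJaffe1985], §7.3 p. 326 [PDF 28]; [7] there = T. Bałaban, *Regularity and decay of
lattice Green's functions*, Commun. Math. Phys. **89** (1983) 571–597 [Balaban1983RegularityDecay], (1.10) p. 573; the flat multiscale kernel
input of file 2 is T. Bałaban, *(Higgs)₂,₃ quantum fields in a finite volume III*, Commun. Math. Phys. **88** (1983) 411–445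
[Balaban1983Higgs3], (2.10), as landed in the tree (`Balaban1983to89.B3Sect3KernelsZeroTorus.gpiece_bounds`).

statement-level skeleton of published theorems with citation tags; proofs where landed; nothing here is a claim about the Yang–Mills mass gap

PDF held: `paper:balaban1985-cmp97-bij-higgs-minimizers` (p. 326 = PDF 28, p. 313 = PDF 15); text layer of p. 326 re-read this session
(`lit read … --pages 28`).

CITATION HEADER (lean-in-tree rule).  Part of the lit-balaban TYPED SKELETON (HOME `run/shared/lean/pub/lit-balaban/`), PHASE-2 proof seat
p27 gen 32 (unit `lit-balaban-p27-g32`; TAKING line HOME/STATUS.md 2026-08-22T19:09:49Z; free-target protocol G.5-34(d) — item 3 of the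
owner's `HOME/lit-balaban-r15/C1-CLOSURE.md` §5 (owner r15, referee ref-5): *"a small-field (non-flat u_k) SUP-NORM decay member of the p. 326
propagator sentence in [6]'s (1.9)/(1.10) shape (p31 g16 `BIJ88NeumannPropagatorFlatDecay` is the flat template; p33's Agmon members are
L²-pairing decay)"*).  WHAT IS REPRODUCED: the input lemma-chain for the SUP-NORM (value) member of the decay sentence of [BalabanImbrieJaffe1985]
p. 326 (row **C1.Eq7.3.1-7.3.2** of `HOME/lit-balaban-r15/ROWS-C1.md`; a located member of that row, no head effect), the member itself being
file 3's `BIJ85ScalarPropagatorSupDecay.decay110_smallField`.  Kind «model-level theorems only» (no new definition, no `Prop`-valued fact).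

THE PRINTED TEXT (verbatim, p. 326 [PDF 28]): *"These inequalities can be proved by an extension of the proofs of [7]. The propagators arising
from Δ_k(u_k), under the restriction (7.3.1) on the gauge field, also satisfy the regularity and decay estimates of [7]. In order to remain
within the framework of this reference, we remark that by change of gauge u_k can be transformed in a local region Λ into a configuration of
the form exp[ie_kηA], where A is smooth and small."*  [7] (1.10) p. 573 (as transcribed in the tree's `Balaban1983to89.B4Thm110ZeroTorus`):
*"|(D^η_{A,μ}G_k(Ω, A)f)(x)|, |(G_k(Ω, A)f)(x)| ≤ c₀exp(−δ₀ dist(x, supp f))‖f‖_∞ (1.10)"*.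

THE MECHANISM OF THE THREE FILES (DIVERGENCE OF METHOD from the printed route — [7]'s random-walk expansion after a local change of gauge to a
small smooth `A` — disclosed; same SHAPE of statement, the (1.10) VALUE member).  With `T(u) = D_u^*D_u + a′Q_k(u)^*Q_k(u)` (p31's `nOp`,
`c = ε⁻¹`, `a′ = α_kL^{kd}`), `φ = G_k(T,u)f`, `m = (L^kε)^{−2}`:  (1) KATO'S INEQUALITY (file 3): `((−Δ^ε + m)|φ|)(x) ≤ |((D_u^*D_u + m)φ)(x)|
≤ |f(x)| + α_k(Q_k^*Q_k|φ|)(x) + m|φ(x)| =: g(x)` pointwise (`|u_b| = 1`, `|u(Γ)| = 1`; gauge-blind, so no gauge fixing is needed and flux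
sectors are immaterial), whence by the MINIMUM PRINCIPLE for the M-matrix `−Δ^ε + m` (this file, §2) `|φ(x)| ≤ (Rg)(x)`, `R = (−Δ^ε + m)⁻¹ ≥ 0`.
(2) CAUCHY–SCHWARZ with the weight `w(z) = e^{t|x−z|_∞/L^k}`: `(Rg)(x)² ≤ [Σ_z w(z)²R(x,z)²]·[Σ_z w(z)^{−2}g(z)²]`.  (3) THE TILTED ROW BOUND
(file 2, `d ≤ 3`): `Σ_z w(z)²R(x,z)² ≤ C₀(L^kε)⁴L^{−kd}`, from the RESOLVENT IDENTITY `R = G_k(T_ε,0) + R(α_kQ_k^*Q_k − m)G_k(T_ε,0)` (this file,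
§4), the free Agmon bound `Σ(wRv)² ≤ Σ(wv)²/(m − κ₀)²`, `κ₀ = dε^{−2}S₁` (this file, §3), the tilted bound of the block average (§4) and the
multiscale kernel bounds `|G^η_{(i)}(z,x)| ≤ C(L^iε)^{2−d}e^{−δ|z−x|/L^i}` of [Balaban1983Higgs3] (2.10) for the flat block propagator.  (4) p33's
WEIGHTED `L²` (AGMON) BOUND `BIJ85ScalarPropagatorDecay.agmon_weighted` with the `x`-centred weight `ω = w⁻¹ = e^{−t|x−·|_∞/L^k}`:
`Σ_zω²|φ|² ≤ (2(L^kε)²/μ₀)²Σ_zω²|f|²`, `μ₀ = min(a/4, 1/4)`, under p33's block-scale plaquette smallness `2d³(L^{2k}θ)² ≤ 1`; and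
`Σ_zω(z)²|f(z)|² ≤ F²e^{−tD/L^k}K_tL^{kd}` for `|f| ≤ F` vanishing within `ℓ^∞`-distance `D` of `x`.  Together:
`|φ(x)| ≤ c₀(L^kε)²e^{−tD/(2L^k)}F`.

WHAT IS PROVED IN THIS FILE (theorems only; 0 `sorry`; standard axioms; no new definition, no `Prop`-valued fact).  `H P m` is pv07's
`B1RG242Torus.H` (`−Δ^ε + m` on the fine torus `Site P 0`, spacing `ε`), `(tower P a 0).G k` its flat block propagator `(−Δ^ε + α_kQ_k^*Q_k)⁻¹`.
* §1 `transpose_shiftMat_mulVec`, `transpose_deriv_mulVec`, **`H_mulVec_apply`** (`(H_mv)(x) = mv(x) + ε^{−2}Σ_μ((v(x) − v(x+e_μ)) + (v(x) − v(x−e_μ)))`),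
  `H_mulVec_const`.
* §2 **`nonneg_of_H_mulVec_nonneg`** (minimum principle), `isUnit_H`, `H_mul_inv`, `inv_mul_H`, `inv_H_mulVec_nonneg`, **`le_inv_H_mulVec`**
  (comparison), `inv_H_apply_nonneg`, `inv_H_mulVec_const`, `sum_inv_H_apply` (`Σ_zR(x,z) = 1/m`), `H_transpose`, `inv_H_transpose`.
* §3 `dotProduct_H_mulVec`, (private) `sum_shift_eq`, **`agmon_free`** (the free Combes–Thomas bound `Σ_x(w(Rg))² ≤ Σ_x(wg)²/(m − dε^{−2}S₁)²`
  in a weight with bond oscillation `(w(z+e_μ) − w(z))² ≤ S₁w(z+e_μ)w(z)`, `dε^{−2}S₁ < m`).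
* §4 `H_eq_smul_one_add`, `tower_G_eq`, `towerOp_mul_G`, **`resolvent_identity`**, `towerQQ_mulVec_apply`, `blockWeight_mul_card`,
  **`tilted_sq_QQ_le`** (`Σ_z(w(Q_k^*Q_ku))² ≤ e^{2t}Σ_z(wu)²` if `w` oscillates by `≤ e^t` inside `k`-blocks).
* §5 `abs_supDist_shift_sub_le`, **`weight_bond_osc`**, **`weight_block_osc`** for `w(z) = e^{t|x−z|_∞/L^k}`.

HONEST SCOPE.  Free-lattice analysis only (no gauge field in this file); whole fine torus `Site P 0` of `Setup` (no sub-domains `Ω`);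
constants explicit and ours.  Nothing here is summit progress.  Unit `lit-balaban-p27` (literature-prover-lit-balaban-p27-g32-0), HOME
`run/shared/lean/pub/lit-balaban/`, 2026-08-22.
-/

open scoped BigOperators
open Finset Matrix

namespace Literature.MathematicalPhysics.QuantumFieldTheory.BalabanImbrieJaffe1984to88.BIJ85FreeResolventTorus

open Literature.MathematicalPhysics.QuantumFieldTheory.Balaban1983to89
open B1RG242Torus (H hOp deriv shiftMat tower)
open LatticeFieldCalculus (supDist shiftEquiv)

noncomputable section

variable {P : Params}

/-! ## §1 The massive free Laplacian `H_m = −Δ^ε + m` of pv07 (`B1RG242Torus.H P m`) acts pointwise -/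

/-- kernel: the transposed shift acts as the backward shift, `(S_μᵀw)(x) = w(x − e_μ)`. [cite: Balaban1982Higgs1, (1.4) p.604] -/
theorem transpose_shiftMat_mulVec (μ : Fin P.d) (w : Balaban1983to89.Site P 0 → ℝ) (x : Balaban1983to89.Site P 0) :
    ((shiftMat P 0 μ)ᵀ *ᵥ w) x = w (x.unshift μ) := by
  simp only [mulVec, dotProduct, transpose_apply, B1RG242Torus.shiftMat]
  have key : ∀ x' : Balaban1983to89.Site P 0, (if x = x'.shift μ then (1 : ℝ) else 0) * w x' = if x' = x.unshift μ then w x' else 0 := by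
    intro x'
    have e : (x = x'.shift μ) ↔ (x' = x.unshift μ) := by
      constructor
      · rintro rfl; exact ((shiftEquiv μ).left_inv x').symm
      · rintro rfl; exact ((shiftEquiv μ).right_inv x).symm
    by_cases h : x' = x.unshift μ
    · rw [if_pos (e.2 h), if_pos h, one_mul]
    · rw [if_neg (fun h' => h (e.1 h')), if_neg h, zero_mul]
  simp_rw [key]
  rw [sum_ite_eq' univ, if_pos (mem_univ _)]

/-- kernel: the transposed forward derivative, `(∂_μᵀw)(x) = ε⁻¹(w(x − e_μ) − w(x))`. [cite: Balaban1982Higgs1, (1.4) p.604] -/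
theorem transpose_deriv_mulVec (s : ℝ) (μ : Fin P.d) (w : Balaban1983to89.Site P 0 → ℝ) (x : Balaban1983to89.Site P 0) :
    ((deriv P 0 s μ)ᵀ *ᵥ w) x = s⁻¹ * (w (x.unshift μ) - w x) := by
  simp only [B1RG242Torus.deriv, transpose_smul, transpose_sub, transpose_one, smul_mulVec, sub_mulVec, one_mulVec,
    Pi.smul_apply, Pi.sub_apply, transpose_shiftMat_mulVec, smul_eq_mul]

/-- **`(H_m v)(x) = m·v(x) + ε⁻²Σ_μ((v(x) − v(x+e_μ)) + (v(x) − v(x−e_μ)))`** — pv07's `−Δ^ε + m²` of [Balaban1982Higgs1] (1.11) site by site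
(the mass parameter of `B1RG242Torus.H` is used here as the coefficient `m` of the identity). [cite: BalabanImbrieJaffe1985, (4.6.3) p.313] -/
theorem H_mulVec_apply (m : ℝ) (v : Balaban1983to89.Site P 0 → ℝ) (x : Balaban1983to89.Site P 0) :
    (H P m *ᵥ v) x = m * v x + ∑ μ : Fin P.d, (P.eps⁻¹) ^ 2 * ((v x - v (x.shift μ)) + (v x - v (x.unshift μ))) := by
  rw [B1RG242Torus.H, B1RG242Torus.hOp_mulVec, Pi.add_apply, Pi.smul_apply, smul_eq_mul, Finset.sum_apply]
  congr 1
  refine sum_congr rfl fun μ _ => ?_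
  rw [transpose_deriv_mulVec, B1RG242Torus.deriv_mulVec, B1RG242Torus.deriv_mulVec]
  have e : (x.unshift μ).shift μ = x := (shiftEquiv μ).right_inv x
  rw [e]
  ring

/-- kernel: `H_m` applied to a constant: `(H_m c)(x) = m·c`. [cite: Balaban1982Higgs1, (2.17) p.610] -/
theorem H_mulVec_const (m c : ℝ) (x : Balaban1983to89.Site P 0) : (H P m *ᵥ fun _ => c) x = m * c := by
  rw [H_mulVec_apply]; simp

/-! ## §2 The minimum principle; `R = H_m⁻¹` exists, is entrywise nonnegative and order preserving -/

/-- **MINIMUM PRINCIPLE** for `−Δ^ε + m`, `m > 0`: if `(H_m v)(x) ≥ 0` at every site then `v ≥ 0` (at a minimum point `x₀` of `v` every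
difference `v(x₀) − v(x₀ ± e_μ)` is `≤ 0`, so `0 ≤ (H_mv)(x₀) ≤ m·v(x₀)`). [cite: Balaban1982Higgs1, (2.17) p.610] -/
theorem nonneg_of_H_mulVec_nonneg {m : ℝ} (hm : 0 < m) (v : Balaban1983to89.Site P 0 → ℝ) (h : ∀ x, 0 ≤ (H P m *ᵥ v) x) : ∀ x, 0 ≤ v x := by
  obtain ⟨x₀, -, hx₀⟩ := exists_min_image univ v univ_nonempty
  have hle : (H P m *ᵥ v) x₀ ≤ m * v x₀ := by
    rw [H_mulVec_apply]
    have hs : ∑ μ : Fin P.d, (P.eps⁻¹) ^ 2 * ((v x₀ - v (x₀.shift μ)) + (v x₀ - v (x₀.unshift μ))) ≤ 0 :=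
      sum_nonpos fun μ _ => mul_nonpos_of_nonneg_of_nonpos (sq_nonneg _)
        (add_nonpos (sub_nonpos.2 (hx₀ _ (mem_univ _))) (sub_nonpos.2 (hx₀ _ (mem_univ _))))
    linarith
  have h0 : 0 ≤ v x₀ := by
    have h1 : 0 ≤ m * v x₀ := (h x₀).trans hle
    by_contra hneg
    have : m * v x₀ < 0 := mul_neg_of_pos_of_neg hm (lt_of_not_ge hneg)
    linarith
  exact fun x => h0.trans (hx₀ x (mem_univ _))


/-- **`H_m = −Δ^ε + m` IS INVERTIBLE** for `m > 0` (injectivity from the minimum principle applied to `±v`). [cite: Balaban1982Higgs1, (2.17) p.610] -/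
theorem isUnit_H {m : ℝ} (hm : 0 < m) : IsUnit (H P m) := by
  rw [← Matrix.mulVec_injective_iff_isUnit]
  intro v v' hvv'
  have hz : H P m *ᵥ (v - v') = 0 := by rw [mulVec_sub, hvv', sub_self]
  have h1 := nonneg_of_H_mulVec_nonneg hm (v - v') fun x => by rw [hz]; rfl
  have h2 := nonneg_of_H_mulVec_nonneg hm (v' - v) fun x => by
    rw [show v' - v = -(v - v') by abel, mulVec_neg, hz, neg_zero]; rfl
  funext x
  have a := h1 x; have b := h2 x
  simp only [Pi.sub_apply] at a b
  linarith

/-- kernel: `H_m·H_m⁻¹ = 1`. [cite: Balaban1982Higgs1, (2.17) p.610] -/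
theorem H_mul_inv {m : ℝ} (hm : 0 < m) : H P m * (H P m)⁻¹ = 1 :=
  mul_nonsing_inv _ ((isUnit_iff_isUnit_det _).mp (isUnit_H hm))

/-- kernel: `H_m⁻¹·H_m = 1`. [cite: Balaban1982Higgs1, (2.17) p.610] -/
theorem inv_mul_H {m : ℝ} (hm : 0 < m) : (H P m)⁻¹ * H P m = 1 :=
  nonsing_inv_mul _ ((isUnit_iff_isUnit_det _).mp (isUnit_H hm))

/-- **THE FREE RESOLVENT IS POSITIVITY PRESERVING**: `g ≥ 0 ⟹ (−Δ^ε + m)⁻¹g ≥ 0`. [cite: Balaban1982Higgs1, (2.17) p.610] -/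
theorem inv_H_mulVec_nonneg {m : ℝ} (hm : 0 < m) {g : Balaban1983to89.Site P 0 → ℝ} (hg : ∀ x, 0 ≤ g x) (x : Balaban1983to89.Site P 0) :
    0 ≤ ((H P m)⁻¹ *ᵥ g) x :=
  nonneg_of_H_mulVec_nonneg hm _ (fun z => by rw [mulVec_mulVec, H_mul_inv hm, one_mulVec]; exact hg z) x

/-- **COMPARISON PRINCIPLE**: `H_mv ≤ g` pointwise ⟹ `v ≤ H_m⁻¹g` pointwise. [cite: Balaban1982Higgs1, (2.17) p.610] -/
theorem le_inv_H_mulVec {m : ℝ} (hm : 0 < m) {v g : Balaban1983to89.Site P 0 → ℝ} (h : ∀ x, (H P m *ᵥ v) x ≤ g x)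
    (x : Balaban1983to89.Site P 0) : v x ≤ ((H P m)⁻¹ *ᵥ g) x := by
  have key := nonneg_of_H_mulVec_nonneg hm ((H P m)⁻¹ *ᵥ g - v) (fun z => by
    rw [mulVec_sub, mulVec_mulVec, H_mul_inv hm, one_mulVec, Pi.sub_apply]
    exact sub_nonneg.2 (h z)) x
  rw [Pi.sub_apply] at key
  linarith

/-- kernel: the entries of `(−Δ^ε + m)⁻¹` are nonnegative. [cite: Balaban1982Higgs1, (2.17) p.610] -/
theorem inv_H_apply_nonneg {m : ℝ} (hm : 0 < m) (x z : Balaban1983to89.Site P 0) : 0 ≤ (H P m)⁻¹ x z := by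
  have h := inv_H_mulVec_nonneg hm (g := Pi.single z 1) (fun y => by
    by_cases hy : y = z
    · subst hy; simp
    · simp [hy]) x
  rwa [mulVec_single, MulOpposite.op_one, one_smul] at h

/-- kernel: `(−Δ^ε + m)⁻¹` applied to the constant `c` is the constant `c/m`. [cite: Balaban1982Higgs1, (2.17) p.610] -/
theorem inv_H_mulVec_const {m : ℝ} (hm : 0 < m) (c : ℝ) :
    (H P m)⁻¹ *ᵥ (fun _ : Balaban1983to89.Site P 0 => c) = fun _ => c / m := by
  have h1 : H P m *ᵥ (fun _ : Balaban1983to89.Site P 0 => c / m) = fun _ => c := by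
    funext x; rw [H_mulVec_const]; field_simp
  rw [← h1, mulVec_mulVec, inv_mul_H hm, one_mulVec]

/-- kernel: the row sums of `(−Δ^ε + m)⁻¹` are `1/m`. [cite: Balaban1982Higgs1, (2.17) p.610] -/
theorem sum_inv_H_apply {m : ℝ} (hm : 0 < m) (x : Balaban1983to89.Site P 0) : ∑ z, (H P m)⁻¹ x z = 1 / m := by
  have h := congrFun (inv_H_mulVec_const hm (1 : ℝ)) x
  simp only [mulVec, dotProduct, mul_one] at h
  exact h

/-- kernel: `H_m` is symmetric. [cite: Balaban1982Higgs1, (2.17) p.610] -/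
theorem H_transpose (m : ℝ) : (H P m)ᵀ = H P m := by
  rw [B1RG242Torus.H, B1RG242Torus.hOp, transpose_add, transpose_smul, transpose_one, transpose_sum]
  congr 1
  exact sum_congr rfl fun μ _ => by rw [transpose_mul, transpose_transpose]

/-- kernel: `(−Δ^ε + m)⁻¹` is symmetric. [cite: Balaban1982Higgs1, (2.17) p.610] -/
theorem inv_H_transpose (m : ℝ) : ((H P m)⁻¹)ᵀ = (H P m)⁻¹ := by
  rw [transpose_nonsing_inv, H_transpose]

/-! ## §3 The free Agmon (Combes–Thomas) bound in the weighted `ℓ²` norm -/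

/-- kernel: the bilinear form of `H_m`: `ψ·(H_mφ) = m(ψ·φ) + Σ_μ(∂_μψ)·(∂_μφ)`. [cite: Balaban1982Higgs1, (1.8) p.605] -/
theorem dotProduct_H_mulVec (m : ℝ) (ψ φ : Balaban1983to89.Site P 0 → ℝ) :
    ψ ⬝ᵥ (H P m *ᵥ φ) = m * (ψ ⬝ᵥ φ) + ∑ μ, (deriv P 0 P.eps μ *ᵥ ψ) ⬝ᵥ (deriv P 0 P.eps μ *ᵥ φ) := by
  rw [B1RG242Torus.H, B1RG242Torus.hOp_mulVec, dotProduct_add, dotProduct_smul, smul_eq_mul, dotProduct_sum]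
  congr 1
  refine sum_congr rfl fun μ _ => ?_
  rw [dotProduct_mulVec, vecMul_transpose]

/-- kernel: a sum over the torus is invariant under the shift `x ↦ x + e_μ`. [folklore] -/
private theorem sum_shift_eq (μ : Fin P.d) (f : Balaban1983to89.Site P 0 → ℝ) :
    ∑ x : Balaban1983to89.Site P 0, f (x.shift μ) = ∑ x, f x :=
  Fintype.sum_equiv (shiftEquiv μ) _ _ fun _ => rfl

/-- **THE FREE AGMON BOUND**: for a positive weight `w` with `(w(x+e_μ) − w(x))² ≤ S₁·w(x+e_μ)w(x)` on every bond and
`κ₀ := d·ε⁻²·S₁ < m`, the resolvent satisfies `‖w·(−Δ^ε+m)⁻¹g‖₂ ≤ ‖w·g‖₂/(m − κ₀)` (energy method: test `H_mφ = g` against `w²φ`; the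
bond identity `(w₊²φ₊ − w₋²φ₋)(φ₊ − φ₋) = (w₊φ₊ − w₋φ₋)² − (w₊ − w₋)²φ₊φ₋` is second order in the oscillation of `w`). Stated with squares.
[cite: BalabanImbrieJaffe1985, (7.3.2) p.326] -/
theorem agmon_free {m : ℝ} (hm : 0 < m) {w : Balaban1983to89.Site P 0 → ℝ} {S₁ : ℝ} (hS₁ : 0 ≤ S₁) (hwpos : ∀ x, 0 < w x)
    (hw : ∀ (x : Balaban1983to89.Site P 0) (μ : Fin P.d), (w (x.shift μ) - w x) ^ 2 ≤ S₁ * (w (x.shift μ) * w x))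
    (hκ : P.d * (P.eps⁻¹) ^ 2 * S₁ < m) (g : Balaban1983to89.Site P 0 → ℝ) :
    ∑ x, (w x * ((H P m)⁻¹ *ᵥ g) x) ^ 2 ≤ (∑ x, (w x * g x) ^ 2) / (m - P.d * (P.eps⁻¹) ^ 2 * S₁) ^ 2 := by
  set φ : Balaban1983to89.Site P 0 → ℝ := (H P m)⁻¹ *ᵥ g with hφ
  set κ : ℝ := P.d * (P.eps⁻¹) ^ 2 * S₁ with hκdef
  have hHφ : H P m *ᵥ φ = g := by rw [hφ, mulVec_mulVec, H_mul_inv hm, one_mulVec]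
  set A2 : ℝ := ∑ x, (w x * φ x) ^ 2 with hA2
  set B2 : ℝ := ∑ x, (w x * g x) ^ 2 with hB2
  have hA2nn : 0 ≤ A2 := sum_nonneg fun x _ => sq_nonneg _
  have hB2nn : 0 ≤ B2 := sum_nonneg fun x _ => sq_nonneg _
  -- the test function `ψ = w²φ`
  set ψ : Balaban1983to89.Site P 0 → ℝ := fun x => w x ^ 2 * φ x with hψ
  -- (1) `ψ·g ≤ √A2·√B2`
  have h1 : ψ ⬝ᵥ (H P m *ᵥ φ) ≤ Real.sqrt A2 * Real.sqrt B2 := by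
    rw [hHφ]
    have hcs := sum_mul_sq_le_sq_mul_sq univ (fun x => w x * φ x) (fun x => w x * g x)
    have e : ψ ⬝ᵥ g = ∑ x, (w x * φ x) * (w x * g x) := by
      simp only [dotProduct, hψ]; exact sum_congr rfl fun x _ => by ring
    rw [e, ← Real.sqrt_mul hA2nn]
    refine Real.le_sqrt_of_sq_le ?_
    rw [hA2, hB2]
    exact hcs
  -- (2) `ψ·(H_mφ) ≥ (m − κ)A2`
  have h2 : (m - κ) * A2 ≤ ψ ⬝ᵥ (H P m *ᵥ φ) := by
    rw [dotProduct_H_mulVec]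
    have eψφ : ψ ⬝ᵥ φ = A2 := by
      simp only [dotProduct, hψ, hA2]; exact sum_congr rfl fun x _ => by ring
    rw [eψφ]
    -- each direction contributes `≥ −ε⁻²S₁·A2`
    have hdir : ∀ μ : Fin P.d, -((P.eps⁻¹) ^ 2 * S₁ * A2) ≤ (deriv P 0 P.eps μ *ᵥ ψ) ⬝ᵥ (deriv P 0 P.eps μ *ᵥ φ) := by
      intro μ
      simp only [dotProduct, B1RG242Torus.deriv_mulVec]
      have hpt : ∀ x : Balaban1983to89.Site P 0,
          -((P.eps⁻¹) ^ 2 * (S₁ / 2) * ((w (x.shift μ) * φ (x.shift μ)) ^ 2 + (w x * φ x) ^ 2)) ≤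
            P.eps⁻¹ * (ψ (x.shift μ) - ψ x) * (P.eps⁻¹ * (φ (x.shift μ) - φ x)) := by
        intro x
        simp only [hψ]
        have hid : P.eps⁻¹ * (w (x.shift μ) ^ 2 * φ (x.shift μ) - w x ^ 2 * φ x) * (P.eps⁻¹ * (φ (x.shift μ) - φ x)) =
            (P.eps⁻¹) ^ 2 * ((w (x.shift μ) * φ (x.shift μ) - w x * φ x) ^ 2
              - (w (x.shift μ) - w x) ^ 2 * (φ (x.shift μ) * φ x)) := by ring
        rw [hid]
        have hsq : 0 ≤ (w (x.shift μ) * φ (x.shift μ) - w x * φ x) ^ 2 := sq_nonneg _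
        have hcross : (w (x.shift μ) - w x) ^ 2 * (φ (x.shift μ) * φ x)
            ≤ S₁ / 2 * ((w (x.shift μ) * φ (x.shift μ)) ^ 2 + (w x * φ x) ^ 2) := by
          have hab : |φ (x.shift μ) * φ x| * (w (x.shift μ) * w x)
              ≤ ((w (x.shift μ) * φ (x.shift μ)) ^ 2 + (w x * φ x) ^ 2) / 2 := by
            rw [abs_mul]
            have := two_mul_le_add_sq (w (x.shift μ) * |φ (x.shift μ)|) (w x * |φ x|)
            have hw1 := (hwpos (x.shift μ)).le; have hw2 := (hwpos x).le
            nlinarith [sq_abs (φ (x.shift μ)), sq_abs (φ x), abs_nonneg (φ (x.shift μ)), abs_nonneg (φ x)]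
          calc (w (x.shift μ) - w x) ^ 2 * (φ (x.shift μ) * φ x)
              ≤ (w (x.shift μ) - w x) ^ 2 * |φ (x.shift μ) * φ x| :=
                mul_le_mul_of_nonneg_left (le_abs_self _) (sq_nonneg _)
            _ ≤ S₁ * (w (x.shift μ) * w x) * |φ (x.shift μ) * φ x| :=
                mul_le_mul_of_nonneg_right (hw x μ) (abs_nonneg _)
            _ = S₁ * (|φ (x.shift μ) * φ x| * (w (x.shift μ) * w x)) := by ring
            _ ≤ S₁ * (((w (x.shift μ) * φ (x.shift μ)) ^ 2 + (w x * φ x) ^ 2) / 2) :=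
                mul_le_mul_of_nonneg_left hab hS₁
            _ = S₁ / 2 * ((w (x.shift μ) * φ (x.shift μ)) ^ 2 + (w x * φ x) ^ 2) := by ring
        have hε : 0 ≤ (P.eps⁻¹) ^ 2 := sq_nonneg _
        nlinarith
      have hsum := sum_le_sum fun x (_ : x ∈ (univ : Finset (Balaban1983to89.Site P 0))) => hpt x
      have e2 : ∑ x, -((P.eps⁻¹) ^ 2 * (S₁ / 2) * ((w (x.shift μ) * φ (x.shift μ)) ^ 2 + (w x * φ x) ^ 2))
          = -((P.eps⁻¹) ^ 2 * S₁ * A2) := by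
        rw [sum_neg_distrib, ← mul_sum, sum_add_distrib, sum_shift_eq μ (fun x => (w x * φ x) ^ 2), ← hA2]
        ring
      rw [e2] at hsum
      exact hsum
    have hsumdir := sum_le_sum fun μ (_ : μ ∈ (univ : Finset (Fin P.d))) => hdir μ
    rw [sum_const, card_univ, Fintype.card_fin, nsmul_eq_mul] at hsumdir
    have e3 : (m - κ) * A2 = m * A2 + P.d * -((P.eps⁻¹) ^ 2 * S₁ * A2) := by rw [hκdef]; ring
    rw [e3]
    linarith
  -- (3) conclude
  have hmk : 0 < m - κ := by rw [hκdef]; linarith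
  have h3 : (m - κ) * A2 ≤ Real.sqrt A2 * Real.sqrt B2 := h2.trans h1
  have h4 : (m - κ) * Real.sqrt A2 ≤ Real.sqrt B2 := by
    by_cases hA : Real.sqrt A2 = 0
    · rw [hA, mul_zero]; exact Real.sqrt_nonneg _
    · have hApos : 0 < Real.sqrt A2 := lt_of_le_of_ne (Real.sqrt_nonneg _) (Ne.symm hA)
      have e : (m - κ) * A2 = ((m - κ) * Real.sqrt A2) * Real.sqrt A2 := by
        rw [mul_assoc, Real.mul_self_sqrt hA2nn]
      rw [e, mul_comm (Real.sqrt A2) (Real.sqrt B2)] at h3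
      exact le_of_mul_le_mul_right h3 hApos
  have h5 : ((m - κ) * Real.sqrt A2) ^ 2 ≤ (Real.sqrt B2) ^ 2 :=
    pow_le_pow_left₀ (mul_nonneg hmk.le (Real.sqrt_nonneg _)) h4 2
  rw [mul_pow, Real.sq_sqrt hA2nn, Real.sq_sqrt hB2nn] at h5
  rw [le_div_iff₀ (pow_pos hmk 2)]
  linarith

/-! ## §4 The resolvent identity against the flat BLOCK propagator `G_k(T_ε,0) = (−Δ^ε + α_kQ_k^*Q_k)⁻¹` of pv07's tower -/

/-- kernel: `H_m = m·1 + H_0`. [cite: Balaban1982Higgs1, (2.17) p.610] -/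
theorem H_eq_smul_one_add (m : ℝ) : H P m = m • (1 : Matrix _ _ ℝ) + H P 0 := by
  rw [B1RG242Torus.H, B1RG242Torus.H, B1RG242Torus.hOp, B1RG242Torus.hOp, zero_smul, zero_add]

/-- kernel: pv07's tower propagator at level `k` unfolds to the inverse of `−Δ^ε + α_kQ_k^*Q_k`. [cite: Balaban1982Higgs1, (2.20) p.610] -/
theorem tower_G_eq (a msq : ℝ) (k : ℕ) :
    (tower P a msq).G k = (H P msq + B1RG242Torus.α P a k • (B1RG242Torus.Qks P k * B1RG242Torus.Qk P k))⁻¹ := rfl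

/-- kernel: `(−Δ^ε + α_kQ_k^*Q_k)·G_k(T_ε,0) = 1` (`a > 0`, `k ≥ 1`; pv07's `G_arg`). [cite: Balaban1982Higgs1, (2.20) p.610] -/
theorem towerOp_mul_G {a : ℝ} (ha : 0 < a) {k : ℕ} (hk : 1 ≤ k) :
    (H P 0 + B1RG242Torus.α P a k • (B1RG242Torus.Qks P k * B1RG242Torus.Qk P k)) * (tower P a 0).G k = 1 := by
  rw [tower_G_eq]
  exact mul_nonsing_inv _ ((isUnit_iff_isUnit_det _).mp (B1RG242Torus.G_arg (P := P) ha le_rfl k hk))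

/-- **THE RESOLVENT IDENTITY** between the free massive resolvent and the flat block propagator:
`(−Δ^ε+m)⁻¹ = G_k(T_ε,0) + (−Δ^ε+m)⁻¹·(α_kQ_k^*Q_k − m)·G_k(T_ε,0)`. [cite: Balaban1982Higgs1, (2.20) p.610] -/
theorem resolvent_identity {a : ℝ} (ha : 0 < a) {k : ℕ} (hk : 1 ≤ k) {m : ℝ} (hm : 0 < m) :
    (H P m)⁻¹ = (tower P a 0).G k +
      (H P m)⁻¹ * (B1RG242Torus.α P a k • (B1RG242Torus.Qks P k * B1RG242Torus.Qk P k) - m • (1 : Matrix _ _ ℝ)) * (tower P a 0).G k := by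
  have h1 := towerOp_mul_G (P := P) ha hk
  have h2 := inv_mul_H (P := P) hm
  have e : B1RG242Torus.α P a k • (B1RG242Torus.Qks P k * B1RG242Torus.Qk P k) - m • (1 : Matrix _ _ ℝ) =
      (H P 0 + B1RG242Torus.α P a k • (B1RG242Torus.Qks P k * B1RG242Torus.Qk P k)) - H P m := by
    rw [H_eq_smul_one_add m]; abel
  rw [e, Matrix.mul_sub, Matrix.sub_mul, Matrix.mul_assoc, h1, Matrix.mul_one, h2, Matrix.one_mul]
  abel

/-- kernel: the flat block operator `Q_k^*Q_k` of the tower is the block AVERAGE: `(Q_k^*Q_ku)(z) = L^{−kd}Σ_{z′ ∈ B^k(z)}u(z′)`.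
[cite: Balaban1982Higgs1, (2.11) p.609] -/
theorem towerQQ_mulVec_apply {k : ℕ} (hk : k ≤ P.m + P.K) (u : Balaban1983to89.Site P 0 → ℝ) (z : Balaban1983to89.Site P 0) :
    ((B1RG242Torus.Qks P k * B1RG242Torus.Qk P k) *ᵥ u) z =
      (((P.L : ℝ) ^ P.d)⁻¹) ^ k *
        ∑ z' ∈ univ.filter (fun z' : Balaban1983to89.Site P 0 => Balaban1983to89.Site.proj k k z' = Balaban1983to89.Site.proj k k z),
          u z' := by
  rw [← mulVec_mulVec]
  have h1 := B1RG242Torus.Qks_mulVec (P := P) 1 0 hk (B1RG242Torus.Qk P k *ᵥ u) z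
  have h2 := B1RG242Torus.Qk_mulVec (P := P) 1 0 hk u (Balaban1983to89.Site.proj k k z)
  exact h1.trans h2

/-- kernel: the number of fine sites in a `k`-block is `L^{kd}`, as a real number `((L^d)⁻¹)^k·#B^k = 1`. [cite: Balaban1987RG1, (0.3) p.252] -/
theorem blockWeight_mul_card {k : ℕ} (hk : k ≤ P.m + P.K) (z : Balaban1983to89.Site P 0) :
    (((P.L : ℝ) ^ P.d)⁻¹) ^ k *
        ((univ.filter (fun z' : Balaban1983to89.Site P 0 => Balaban1983to89.Site.proj k k z' = Balaban1983to89.Site.proj k k z)).card : ℝ)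
      = 1 := by
  rw [B1RG242Torus.card_Bj hk]
  push_cast
  have hL : (P.L : ℝ) ≠ 0 := P.cast_L_pos.ne'
  rw [← inv_pow, ← pow_mul, ← pow_mul, mul_comm k P.d, ← mul_pow, inv_mul_cancel₀ hL, one_pow]

/-- **TILTED `ℓ²` BOUND OF THE BLOCK AVERAGE**: if the positive weight `w` oscillates by at most the factor `e^t` inside every `k`-block,
`Σ_z w(z)²(Q_k^*Q_ku)(z)² ≤ e^{2t}Σ_z w(z)²u(z)²` (Cauchy–Schwarz in the block and double counting). [cite: BalabanImbrieJaffe1985, (7.3.2) p.326] -/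
theorem tilted_sq_QQ_le {k : ℕ} (hk : k ≤ P.m + P.K) {w : Balaban1983to89.Site P 0 → ℝ} {t : ℝ} (hwpos : ∀ z, 0 < w z)
    (hosc : ∀ z z' : Balaban1983to89.Site P 0,
      Balaban1983to89.Site.proj k k z' = Balaban1983to89.Site.proj k k z → w z ≤ Real.exp t * w z')
    (u : Balaban1983to89.Site P 0 → ℝ) :
    ∑ z, (w z * ((B1RG242Torus.Qks P k * B1RG242Torus.Qk P k) *ᵥ u) z) ^ 2 ≤ Real.exp (2 * t) * ∑ z, (w z * u z) ^ 2 := by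
  classical
  set pr : Balaban1983to89.Site P 0 → Balaban1983to89.Site P k := Balaban1983to89.Site.proj k k with hpr
  set ω : ℝ := (((P.L : ℝ) ^ P.d)⁻¹) ^ k with hω
  have hωpos : 0 < ω := pow_pos (inv_pos.2 (pow_pos P.cast_L_pos _)) _
  -- pointwise: `(w z·(QQu)(z))² ≤ ω·e^{2t}·Σ_{z′ ∈ B(z)} (w z′ u z′)²`
  have hpt : ∀ z : Balaban1983to89.Site P 0,
      (w z * ((B1RG242Torus.Qks P k * B1RG242Torus.Qk P k) *ᵥ u) z) ^ 2 ≤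
        ω * Real.exp (2 * t) * ∑ z' ∈ univ.filter (fun z' => pr z' = pr z), (w z' * u z') ^ 2 := by
    intro z
    rw [towerQQ_mulVec_apply hk]
    set B := univ.filter (fun z' : Balaban1983to89.Site P 0 => pr z' = pr z) with hB
    have hcard : ω * (B.card : ℝ) = 1 := by rw [hω, hB, hpr]; exact blockWeight_mul_card hk z
    -- Cauchy–Schwarz in the block: `(Σ_B u)² ≤ #B·Σ_B u²`
    have hcs : (∑ z' ∈ B, u z') ^ 2 ≤ (B.card : ℝ) * ∑ z' ∈ B, u z' ^ 2 := sq_sum_le_card_mul_sum_sq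
    -- the weight inside the block: `w z² u z′² ≤ e^{2t} (w z′ u z′)²`
    have hwt : ∀ z' ∈ B, w z ^ 2 * u z' ^ 2 ≤ Real.exp (2 * t) * (w z' * u z') ^ 2 := by
      intro z' hz'
      have hzz : pr z' = pr z := (mem_filter.1 hz').2
      have h := hosc z z' hzz
      have hsq : w z ^ 2 ≤ (Real.exp t * w z') ^ 2 := pow_le_pow_left₀ (hwpos z).le h 2
      have e2 : (Real.exp t * w z') ^ 2 = Real.exp (2 * t) * w z' ^ 2 := by
        rw [mul_pow, ← Real.exp_nat_mul]; norm_num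
      rw [e2] at hsq
      nlinarith [sq_nonneg (u z'), sq_nonneg (w z')]
    calc (w z * (ω * ∑ z' ∈ B, u z')) ^ 2 = ω * (w z ^ 2 * (ω * (∑ z' ∈ B, u z') ^ 2)) := by ring
      _ ≤ ω * (w z ^ 2 * (ω * ((B.card : ℝ) * ∑ z' ∈ B, u z' ^ 2))) := by
          gcongr
      _ = ω * ∑ z' ∈ B, w z ^ 2 * u z' ^ 2 := by
          congr 1
          calc w z ^ 2 * (ω * ((B.card : ℝ) * ∑ z' ∈ B, u z' ^ 2)) = (ω * (B.card : ℝ)) * (w z ^ 2 * ∑ z' ∈ B, u z' ^ 2) := by ring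
            _ = ∑ z' ∈ B, w z ^ 2 * u z' ^ 2 := by rw [hcard, one_mul, mul_sum]
      _ ≤ ω * ∑ z' ∈ B, Real.exp (2 * t) * (w z' * u z') ^ 2 :=
          mul_le_mul_of_nonneg_left (sum_le_sum fun z' hz' => hwt z' hz') hωpos.le
      _ = ω * Real.exp (2 * t) * ∑ z' ∈ B, (w z' * u z') ^ 2 := by rw [← mul_sum, mul_assoc]
  refine (sum_le_sum fun z _ => hpt z).trans ?_
  -- double counting: `Σ_z Σ_{z′ ∈ B(z)} F z′ = #B · Σ_{z′} F z′`
  rw [← mul_sum]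
  have hdc : ∑ z : Balaban1983to89.Site P 0, ∑ z' ∈ univ.filter (fun z' => pr z' = pr z), (w z' * u z') ^ 2 =
      ∑ z' : Balaban1983to89.Site P 0, ((univ.filter (fun z => pr z = pr z')).card : ℝ) * (w z' * u z') ^ 2 := by
    simp_rw [sum_filter]
    rw [sum_comm]
    refine sum_congr rfl fun z' _ => ?_
    rw [← sum_filter, sum_const, nsmul_eq_mul]
    congr 3
    exact Finset.filter_congr fun z _ => eq_comm
  rw [hdc, mul_sum, mul_sum]
  refine sum_le_sum fun z' _ => ?_
  have hcard' : ω * ((univ.filter (fun z => pr z = pr z')).card : ℝ) = 1 := by rw [hω, hpr]; exact blockWeight_mul_card hk z'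
  calc ω * Real.exp (2 * t) * (((univ.filter (fun z => pr z = pr z')).card : ℝ) * (w z' * u z') ^ 2)
      = (ω * ((univ.filter (fun z => pr z = pr z')).card : ℝ)) * (Real.exp (2 * t) * (w z' * u z') ^ 2) := by ring
    _ = Real.exp (2 * t) * (w z' * u z') ^ 2 := by rw [hcard', one_mul]
    _ ≤ Real.exp (2 * t) * (w z' * u z') ^ 2 := le_rfl

/-! ## §5 The exponential weight `e^{t|x−z|_∞/L^k}` in the block distance: bond and block oscillation -/

/-- kernel: one lattice step changes the `ℓ^∞` distance to a fixed site by at most `1`. [cite: BalabanImbrieJaffe1985, (7.3.2) p.326] -/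
theorem abs_supDist_shift_sub_le (x z : Balaban1983to89.Site P 0) (μ : Fin P.d) :
    |(supDist x (z.shift μ) : ℝ) - supDist x z| ≤ 1 := by
  have h1 : supDist x (z.shift μ) ≤ supDist x z + 1 :=
    (BIJ85Ineq722Torus.supDist_triangle x z (z.shift μ)).trans
      (Nat.add_le_add_left (BIJ85ScalarPropagatorDecay.supDist_src_tgt_le (⟨z, μ⟩ : PBond P 0)) _)
  have h2 : supDist x z ≤ supDist x (z.shift μ) + 1 := by
    have h := BIJ85Ineq722Torus.supDist_triangle x (z.shift μ) z
    have h' : supDist (z.shift μ) z ≤ 1 := by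
      rw [B3TorusRadialSums.supDist_comm]; exact BIJ85ScalarPropagatorDecay.supDist_src_tgt_le (⟨z, μ⟩ : PBond P 0)
    omega
  rw [abs_sub_le_iff]
  constructor
  · have : ((supDist x (z.shift μ) : ℕ) : ℝ) ≤ (supDist x z : ℕ) + 1 := by exact_mod_cast h1
    linarith
  · have : ((supDist x z : ℕ) : ℝ) ≤ (supDist x (z.shift μ) : ℕ) + 1 := by exact_mod_cast h2
    linarith

/-- **BOND OSCILLATION of `w(z) = e^{t|x−z|_∞/L^k}`**: `(w(z+e_μ) − w(z))² ≤ (t/L^k)²e^{t/L^k}·w(z+e_μ)w(z)` (`t ≥ 0`).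
[cite: BalabanImbrieJaffe1985, (7.3.2) p.326] -/
theorem weight_bond_osc {t : ℝ} (ht : 0 ≤ t) (k : ℕ) (x z : Balaban1983to89.Site P 0) (μ : Fin P.d) :
    (Real.exp (t * (supDist x (z.shift μ) : ℝ) / (P.L : ℝ) ^ k) - Real.exp (t * (supDist x z : ℝ) / (P.L : ℝ) ^ k)) ^ 2 ≤
      (t / (P.L : ℝ) ^ k) ^ 2 * Real.exp (t / (P.L : ℝ) ^ k) *
        (Real.exp (t * (supDist x (z.shift μ) : ℝ) / (P.L : ℝ) ^ k) * Real.exp (t * (supDist x z : ℝ) / (P.L : ℝ) ^ k)) := by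
  refine BIJ85AgmonDefect.sq_exp_sub_exp_le_of_abs_le ?_
  have hn : 0 < (P.L : ℝ) ^ k := pow_pos P.cast_L_pos k
  rw [← sub_div, ← mul_sub, abs_div, abs_mul, abs_of_nonneg ht, abs_of_pos hn]
  exact div_le_div_of_nonneg_right (mul_le_of_le_one_right ht (abs_supDist_shift_sub_le x z μ)) hn.le

/-- **BLOCK OSCILLATION of `w(z) = e^{t|x−z|_∞/L^k}`**: inside one `k`-block (`⌊z/L^k⌋ = ⌊z′/L^k⌋`, where `|z − z′|_∞ ≤ L^k − 1`)
`w(z) ≤ e^t·w(z′)` (`t ≥ 0`, `k ≤ m + K`). [cite: BalabanImbrieJaffe1985, (7.3.2) p.326] -/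
theorem weight_block_osc {t : ℝ} (ht : 0 ≤ t) {k : ℕ} (hk : k ≤ P.m + P.K) (x z z' : Balaban1983to89.Site P 0)
    (hzz : Balaban1983to89.Site.proj k k z' = Balaban1983to89.Site.proj k k z) :
    Real.exp (t * (supDist x z : ℝ) / (P.L : ℝ) ^ k) ≤ Real.exp t * Real.exp (t * (supDist x z' : ℝ) / (P.L : ℝ) ^ k) := by
  have hk0 : 0 + k ≤ P.m + P.K := by omega
  have hb : BIJ85BlockAveragesTorusK.blkIter k z' = BIJ85BlockAveragesTorusK.blkIter k z := by
    rw [BIJ88NeumannPropagatorFlatDecay.blkIter_eq_iff_proj_eq hk, B1RG242Torus.lvl_of_le P hk]; exact hzz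
  have hd : supDist z' z ≤ P.L ^ k - 1 := BIJ85ScalarPropagatorDecay.supDist_le_of_blkIter_eq hk0 hb
  have htri : supDist x z ≤ supDist x z' + supDist z' z := BIJ85Ineq722Torus.supDist_triangle x z' z
  have hn : 0 < (P.L : ℝ) ^ k := pow_pos P.cast_L_pos k
  have hLk : (1 : ℕ) ≤ P.L ^ k := Nat.one_le_pow _ _ P.L_pos
  have hreal : (supDist x z : ℝ) ≤ supDist x z' + ((P.L : ℝ) ^ k - 1) := by
    have h1 : ((supDist x z : ℕ) : ℝ) ≤ (supDist x z' : ℕ) + (supDist z' z : ℕ) := by exact_mod_cast htri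
    have h2 : ((supDist z' z : ℕ) : ℝ) ≤ ((P.L ^ k - 1 : ℕ) : ℝ) := by exact_mod_cast hd
    rw [Nat.cast_sub hLk, Nat.cast_pow, Nat.cast_one] at h2
    linarith
  rw [← Real.exp_add]
  refine Real.exp_le_exp.2 ?_
  rw [div_le_iff₀ hn]
  have e : (t + t * (supDist x z' : ℝ) / (P.L : ℝ) ^ k) * (P.L : ℝ) ^ k = t * (P.L : ℝ) ^ k + t * supDist x z' := by
    field_simp
  rw [e]
  nlinarith [mul_le_mul_of_nonneg_left hreal ht]

end

end Literature.MathematicalPhysics.QuantumFieldTheory.BalabanImbrieJaffe1984to88.BIJ85FreeResolventTorus
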